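import Summits.CriticalPhenomena.CardyFormulaZ2.Theorems.CardyBoundaryCoulombGasHalfPlaneMarkDensityLawDensityIdentification
import Summits.CriticalPhenomena.CardyFormulaZ2.Theorems.CardyBoundaryCoulombGasHalfPlaneMarkDensityLawNearEndRegularity
import Summits.CriticalPhenomena.CardyFormulaZ2.Theorems.CardyBoundaryCoulombGasHalfPlaneMarkDensityLawWindowAllMarks

/-!
# Lead's skeleton (c12-0), cycle 3: the density limits are POSITIVE ON AN OPEN DENSE SET OF MARKS
# (crux `HalfPlaneMarkDensityLaw`, line `Sketch`, a-priori structure of the open stub C⁺)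

Every joint subsequential limit `G` of `P_n(a,b,c,y)` along a strictly increasing `θ` is `C¹` in each mark
(c4-0) and — this seat, cycles 1–2 — STRICTLY monotone in each mark.  A strictly monotone differentiable
function of one variable has nonzero derivative on a dense set (mean value theorem), and a `C¹` one on an
OPEN dense set.  Hence `∂₄G(a,b,c,·) > 0` on an open dense subset of `(c,∞)` — i.e. the crux's own
sequence `lawSeq a b c x (θ j) = θ j · P[E_{θ j}(a,b,c,x)] → ∂₄G(a,b,c,x)` has a POSITIVE limit along `θ`
for an open dense set of fourth marks `x` (the registered positivity stub `stub_densityPositivity` asks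
this at EVERY `x`, along the full sequence) — and likewise `∂₂G > 0` densely in the second mark.
Subsequence-free corollary: near every `x₀ > c` there are marks `x` at which `n · P[E_n(a,b,c,x)]` is
frequently `≥ c₁(x) > 0`.
-/

noncomputable section

namespace Summit.CriticalPhenomena.CardyFormulaZ2.Cruxes.HalfPlaneMarkDensityLaw.SketchLine

open Literature.Probability.Percolation Literature.Probability.LatticeModels
open MeasureTheory Filter Set
open scoped Topology
open Summit.CriticalPhenomena.CardyFormulaZ2.Theorems.HalfPlaneMarkDensityLaw.Negative

namespace DensePos

/-- STUB P1 (real analysis): a strictly increasing function differentiable on `(u,∞)` has positive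
derivative on a dense subset of `(u,∞)`. [folklore] -/
theorem stub_deriv_pos_dense :
    ∀ (f : ℝ → ℝ) (u : ℝ), StrictMonoOn f (Ioi u) → DifferentiableOn ℝ f (Ioi u) →
      Ioi u ⊆ closure {x | u < x ∧ 0 < deriv f x} := by
  sorry

/-- STUB P1' (real analysis, bounded interval): a strictly increasing function differentiable on
`(u,v)` has positive derivative on a dense subset of `(u,v)`. [folklore] -/
theorem stub_deriv_pos_dense_Ioo :
    ∀ (f : ℝ → ℝ) (u v : ℝ), StrictMonoOn f (Ioo u v) → DifferentiableOn ℝ f (Ioo u v) →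
      Ioo u v ⊆ closure {x | u < x ∧ x < v ∧ 0 < deriv f x} := by
  sorry

/-- STUB P2: **`∂₄G > 0` on an open dense subset of `(c,∞)`** for every joint subsequential limit. [folklore] -/
theorem stub_deriv4_pos_openDense :
    ∀ {θ : ℕ → ℕ} {G : ℝ → ℝ → ℝ → ℝ → ℝ},
      (∀ a b c y : ℝ, a < b → b < c → c < y →
        Tendsto (fun n ↦ μ.real (openCrossing halfPlane (arcA a b (θ n))
          (rowIcc ⌊c * (θ n : ℕ)⌋ ⌊y * (θ n : ℕ)⌋))) atTop (𝓝 (G a b c y))) →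
      StrictMono θ → ∀ {a b c : ℝ}, a < b → b < c →
        IsOpen {x | c < x ∧ 0 < deriv (G a b c) x} ∧ Ioi c ⊆ closure {x | c < x ∧ 0 < deriv (G a b c) x} := by
  sorry

/-- STUB P3: along `θ`, the crux's density sequence is eventually bounded below by a positive constant at
every fourth mark where `∂₄G > 0`. [folklore] -/
theorem stub_lawSeq_eventually_ge :
    ∀ {θ : ℕ → ℕ} {G : ℝ → ℝ → ℝ → ℝ → ℝ},
      (∀ a b c y : ℝ, a < b → b < c → c < y →
        Tendsto (fun n ↦ μ.real (openCrossing halfPlane (arcA a b (θ n))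
          (rowIcc ⌊c * (θ n : ℕ)⌋ ⌊y * (θ n : ℕ)⌋))) atTop (𝓝 (G a b c y))) →
      StrictMono θ → ∀ {a b c x : ℝ}, a < b → b < c → c < x → 0 < deriv (G a b c) x →
        ∃ c₁ : ℝ, 0 < c₁ ∧ ∀ᶠ j : ℕ in atTop, c₁ ≤ lawSeq a b c x (θ j) := by
  sorry

/-- STUB P4 (subsequence-free): **near every fourth mark there are marks at which the lattice mark density
is frequently bounded below**: for `a < b < c < x₀` and `ε > 0` there is `x` with `|x − x₀| < ε`, `c < x`, and
`c₁ > 0` with `c₁ ≤ n · P[E_n(a,b,c,x)]` for infinitely many `n`. [folklore] -/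
theorem stub_lawSeq_frequently_ge_near :
    ∀ (a b c x₀ ε : ℝ), a < b → b < c → c < x₀ → 0 < ε →
      ∃ x : ℝ, |x - x₀| < ε ∧ c < x ∧ ∃ c₁ : ℝ, 0 < c₁ ∧ ∃ᶠ n : ℕ in atTop, c₁ ≤ lawSeq a b c x n := by
  sorry

/-- STUB P5: **`∂₂G > 0` on a dense subset of `(a,c)`** for every joint subsequential limit (`c < y`). [folklore] -/
theorem stub_deriv2_pos_dense :
    ∀ {θ : ℕ → ℕ} {G : ℝ → ℝ → ℝ → ℝ → ℝ},
      (∀ a b c y : ℝ, a < b → b < c → c < y →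
        Tendsto (fun n ↦ μ.real (openCrossing halfPlane (arcA a b (θ n))
          (rowIcc ⌊c * (θ n : ℕ)⌋ ⌊y * (θ n : ℕ)⌋))) atTop (𝓝 (G a b c y))) →
      StrictMono θ → ∀ {a c y : ℝ}, a < c → c < y →
        Ioo a c ⊆ closure {s | a < s ∧ s < c ∧ 0 < deriv (fun s ↦ G a s c y) s} := by
  sorry

/-! ### Glue forms -/

/-- STUB P2' (glue): P1 gives P2 (`Density.hasDerivAt_jointLimit`, `Density.continuousOn_deriv_jointLimit`,
`Window.stub_jointLimit_strictMono`). [folklore] -/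
theorem stub_deriv4_pos_openDense_of :
    (∀ (f : ℝ → ℝ) (u : ℝ), StrictMonoOn f (Ioi u) → DifferentiableOn ℝ f (Ioi u) →
      Ioi u ⊆ closure {x | u < x ∧ 0 < deriv f x}) →
    ∀ {θ : ℕ → ℕ} {G : ℝ → ℝ → ℝ → ℝ → ℝ},
      (∀ a b c y : ℝ, a < b → b < c → c < y →
        Tendsto (fun n ↦ μ.real (openCrossing halfPlane (arcA a b (θ n))
          (rowIcc ⌊c * (θ n : ℕ)⌋ ⌊y * (θ n : ℕ)⌋))) atTop (𝓝 (G a b c y))) →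
      StrictMono θ → ∀ {a b c : ℝ}, a < b → b < c →
        IsOpen {x | c < x ∧ 0 < deriv (G a b c) x} ∧ Ioi c ⊆ closure {x | c < x ∧ 0 < deriv (G a b c) x} := by
  sorry

/-- STUB P4' (glue): P2 and P3 give P4 (`Subseq.exists_jointSubseqLimit`). [folklore] -/
theorem stub_lawSeq_frequently_ge_near_of :
    (∀ {θ : ℕ → ℕ} {G : ℝ → ℝ → ℝ → ℝ → ℝ},
      (∀ a b c y : ℝ, a < b → b < c → c < y →
        Tendsto (fun n ↦ μ.real (openCrossing halfPlane (arcA a b (θ n))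
          (rowIcc ⌊c * (θ n : ℕ)⌋ ⌊y * (θ n : ℕ)⌋))) atTop (𝓝 (G a b c y))) →
      StrictMono θ → ∀ {a b c : ℝ}, a < b → b < c →
        IsOpen {x | c < x ∧ 0 < deriv (G a b c) x} ∧ Ioi c ⊆ closure {x | c < x ∧ 0 < deriv (G a b c) x}) →
    (∀ {θ : ℕ → ℕ} {G : ℝ → ℝ → ℝ → ℝ → ℝ},
      (∀ a b c y : ℝ, a < b → b < c → c < y →
        Tendsto (fun n ↦ μ.real (openCrossing halfPlane (arcA a b (θ n))
          (rowIcc ⌊c * (θ n : ℕ)⌋ ⌊y * (θ n : ℕ)⌋))) atTop (𝓝 (G a b c y))) →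
      StrictMono θ → ∀ {a b c x : ℝ}, a < b → b < c → c < x → 0 < deriv (G a b c) x →
        ∃ c₁ : ℝ, 0 < c₁ ∧ ∀ᶠ j : ℕ in atTop, c₁ ≤ lawSeq a b c x (θ j)) →
    ∀ (a b c x₀ ε : ℝ), a < b → b < c → c < x₀ → 0 < ε →
      ∃ x : ℝ, |x - x₀| < ε ∧ c < x ∧ ∃ c₁ : ℝ, 0 < c₁ ∧ ∃ᶠ n : ℕ in atTop, c₁ ≤ lawSeq a b c x n := by
  sorry

/-- STUB P5' (glue): P1' gives P5 (`NearEnd…hasDerivAt_jointLimit_second`, `Window.stub_jointLimit_strictMono_second`). [folklore] -/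
theorem stub_deriv2_pos_dense_of :
    (∀ (f : ℝ → ℝ) (u v : ℝ), StrictMonoOn f (Ioo u v) → DifferentiableOn ℝ f (Ioo u v) →
      Ioo u v ⊆ closure {x | u < x ∧ x < v ∧ 0 < deriv f x}) →
    ∀ {θ : ℕ → ℕ} {G : ℝ → ℝ → ℝ → ℝ → ℝ},
      (∀ a b c y : ℝ, a < b → b < c → c < y →
        Tendsto (fun n ↦ μ.real (openCrossing halfPlane (arcA a b (θ n))
          (rowIcc ⌊c * (θ n : ℕ)⌋ ⌊y * (θ n : ℕ)⌋))) atTop (𝓝 (G a b c y))) →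
      StrictMono θ → ∀ {a c y : ℝ}, a < c → c < y →
        Ioo a c ⊆ closure {s | a < s ∧ s < c ∧ 0 < deriv (fun s ↦ G a s c y) s} := by
  sorry

end DensePos

end Summit.CriticalPhenomena.CardyFormulaZ2.Cruxes.HalfPlaneMarkDensityLaw.SketchLine
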